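import Literature.NumberTheory.Sieve.SmoothArcCharacters
import Literature.NumberTheory.Sieve.SmoothArcLocalFactors
import Literature.NumberTheory.Sieve.SmoothTwistedSaddleRange
import HarnessLib

/-!
# The principal part of the smooth-weighted exponential sum at `a/q + λ/x`

Topic `Literature/NumberTheory/Sieve`; a PROVED file toward
`Literature.NumberTheory.DiophantineGeometry.XYZUpperHalf` ([Harper2016, Cor. 1], major arcs at
`a/q`). By `SmoothArcCharacters`, the principal-character part of
`∑_{n ∈ S(x,y)} e(an/q) W_λ(n/x)` is `φ(q)⁻¹ T_{χ₀} = ∑_{g ∣ q} ∑_{d ∣ q/g} μ(q/g)μ(d)/φ(q/g) · S_w(λ; x/(gd))`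
(all divisors of `q` being `y`-smooth), and by `SmoothTwistedSaddleRange.scaledSum_main_term`,
`S_w(λ; x/e) = e^{−α}𝓜Ŵ_λ(α) + O(e^{−α}(ε + e^{−66})𝓜/(1+|λ|))` uniformly in `e ≤ (log x)^{100}`. Hence

`principalPart_estimate`: `‖φ(q)⁻¹ T_{χ₀} − 𝓜 Ŵ_λ(α) G_α(q)‖ ≤ (ε + e^{−66}) H_α(q) 𝓜/(1+|λ|)`

with the local factors `G_α`, `H_α` of `SmoothArcLocalFactors` (`𝓜 = x^α ζ(α,y)/√(2πφ₂(α,y))`,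
`α = α(x,y)`), for `x ≥ x₀(ε)`, `(log x)^4 ≤ y ≤ exp((log x)^{1/5})`, `q ∈ S(y)`, `q ≤ (log x)^{100}`,
`Λ⁸ ≤ y`, `|λ| ≤ Λ`.

## References

* A. J. Harper, Compositio Math. 152 (2016), §2.2, §5 [Harper2016].
* H. L. Montgomery, R. C. Vaughan, Acta Arith. 27 (1975), §5–6 [MontgomeryVaughanActa1975].
-/

noncomputable section

open Finset Real Complex
open scoped ArithmeticFunction.Moebius

namespace Literature.NumberTheory.Sieve

namespace SmoothArcs

open MontgomeryVaughan1975 TwistedWeight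

/-- Divisors of a smooth number are smooth. [folklore] -/
theorem mem_smoothNumbers_of_mem_divisors {q N g : ℕ} (hq : q ∈ Nat.smoothNumbers N) (hg : g ∈ q.divisors) :
    g ∈ Nat.smoothNumbers N :=
  Nat.mem_smoothNumbers_of_dvd hq (Nat.dvd_of_mem_divisors hg)

/-- `φ(q)⁻¹ (φ(q)/φ(q/g)) = φ(q/g)⁻¹` for `g ∣ q` (`φ(q/g) ∣ φ(q)`). [folklore] -/
theorem totient_inv_mul_div {q g : ℕ} (hq : q ≠ 0) (hg : g ∈ q.divisors) :
    ((q.totient : ℂ))⁻¹ * ((Nat.totient q / Nat.totient (q / g) : ℕ) : ℂ) = ((Nat.totient (q / g) : ℂ))⁻¹ := by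
  have hgq : g ∣ q := Nat.dvd_of_mem_divisors hg
  have hdiv : Nat.totient (q / g) ∣ Nat.totient q := Nat.totient_dvd_of_dvd (Nat.div_dvd_of_dvd hgq)
  have hg0 : 0 < g := Nat.pos_of_mem_divisors hg
  have hqg0 : q / g ≠ 0 := (Nat.div_ne_zero_iff_of_dvd hgq).mpr ⟨hq, hg0.ne'⟩
  have hφ : (q.totient : ℂ) ≠ 0 := by exact_mod_cast (Nat.totient_pos.mpr (Nat.pos_of_ne_zero hq)).ne'
  have hφ' : ((q / g).totient : ℂ) ≠ 0 := by exact_mod_cast (Nat.totient_pos.mpr (Nat.pos_of_ne_zero hqg0)).ne'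
  rw [Nat.cast_div hdiv (by exact_mod_cast (Nat.totient_pos.mpr (Nat.pos_of_ne_zero hqg0)).ne')]
  field_simp

/-- **The principal part as a double Möbius sum over the scales `x/(gd)`**: for `q ∈ S(y)`, `q ≥ 1`,
`x ≥ 0`: `φ(q)⁻¹ T_{χ₀} = ∑_{g ∣ q} ∑_{d ∣ q/g} μ(q/g) μ(d)/φ(q/g) · S_w(λ; x/(gd))`.
[cite: MontgomeryVaughanActa1975, §5 (5.2)] -/
theorem principalPart_eq_sum {x : ℝ} (hx : 0 ≤ x) {y q : ℕ} [NeZero q] (hqS : q ∈ Nat.smoothNumbers (y + 1)) (lam : ℝ) :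
    ((q.totient : ℂ))⁻¹ * charTwistSum x y (1 : DirichletCharacter ℂ q) lam =
      ∑ g ∈ q.divisors, ∑ d ∈ (q / g).divisors,
        ((μ (q / g) : ℂ) * (μ d : ℂ) / ((Nat.totient (q / g) : ℂ))) * smoothTwistSum (x / ((g * d : ℕ) : ℝ)) y lam := by
  have hq : q ≠ 0 := NeZero.ne q
  rw [charTwistSum_one hx y lam, Finset.mul_sum]
  refine Finset.sum_congr rfl fun g hg => ?_
  have hgS : g ∈ Nat.smoothNumbers (y + 1) := mem_smoothNumbers_of_mem_divisors hqS hg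
  rw [if_pos hgS]
  have hgq : g ∣ q := Nat.dvd_of_mem_divisors hg
  have hg0 : 0 < g := Nat.pos_of_mem_divisors hg
  have hqg0 : q / g ≠ 0 := (Nat.div_ne_zero_iff_of_dvd hgq).mpr ⟨hq, hg0.ne'⟩
  have hqgS : q / g ∈ Nat.smoothNumbers (y + 1) := Nat.mem_smoothNumbers_of_dvd hqS (Nat.div_dvd_of_dvd hgq)
  rw [coprimeTwistSum_eq_sum_moebius (by positivity) y hqg0 lam, Finset.mul_sum, Finset.mul_sum]
  refine Finset.sum_congr rfl fun d hd => ?_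
  have hdS : d ∈ Nat.smoothNumbers (y + 1) := mem_smoothNumbers_of_mem_divisors hqgS hd
  rw [if_pos hdS]
  have hd0 : 0 < d := Nat.pos_of_mem_divisors hd
  have hscale : x / g / d = x / ((g * d : ℕ) : ℝ) := by push_cast; rw [div_div]
  rw [hscale]
  have h := totient_inv_mul_div hq hg
  calc ((q.totient : ℂ))⁻¹ * ((μ (q / g) : ℂ) * ((Nat.totient q / Nat.totient (q / g) : ℕ) : ℂ) *
        ((μ d : ℂ) * smoothTwistSum (x / ((g * d : ℕ) : ℝ)) y lam))
      = (((q.totient : ℂ))⁻¹ * ((Nat.totient q / Nat.totient (q / g) : ℕ) : ℂ)) *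
          ((μ (q / g) : ℂ) * (μ d : ℂ)) * smoothTwistSum (x / ((g * d : ℕ) : ℝ)) y lam := by ring
    _ = _ := by rw [h, div_eq_mul_inv]; ring

/-- **The principal part estimate.** For every `ε > 0` there is `x₀` such that for `x ≥ x₀`,
`(log x)^4 ≤ y ≤ exp((log x)^{1/5})`, `1 ≤ Λ`, `Λ⁸ ≤ y`, every `y`-smooth `q ≥ 1` with
`q ≤ (log x)^{100}`, and `|λ| ≤ Λ`:
`‖φ(q)⁻¹ T_{χ₀} − 𝓜 Ŵ_λ(α) G_α(q)‖ ≤ (ε + e^{−66}) H_α(q) 𝓜/(1+|λ|)`, `𝓜 = x^α ζ(α,y)/√(2πφ₂(α,y))`.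
[cite: Harper2016, §2.2 (Major Arc Estimate 2) and §5] -/
theorem principalPart_estimate {ε : ℝ} (hε : 0 < ε) :
    ∃ x₀ : ℝ, ∀ (x : ℝ) (y : ℕ), x₀ ≤ x → Real.log x ^ 4 ≤ y → Real.log y ≤ Real.log x ^ (1 / 5 : ℝ) →
      ∀ Λ : ℝ, 1 ≤ Λ → Λ ^ 8 ≤ (y : ℝ) → ∀ (q : ℕ) [NeZero q], q ∈ Nat.smoothNumbers (y + 1) →
      (q : ℝ) ≤ Real.log x ^ 100 → ∀ lam : ℝ, |lam| ≤ Λ →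
      ‖((q.totient : ℂ))⁻¹ * charTwistSum x y (1 : DirichletCharacter ℂ q) lam -
          (((x ^ saddlePoint x y * smoothZeta (saddlePoint x y) y /
              Real.sqrt (2 * Real.pi * saddlePhi₂ (saddlePoint x y) y) : ℝ)) : ℂ) *
            twistMellin lam (saddlePoint x y) * (localG (saddlePoint x y) q : ℂ)‖ ≤
        (ε + Real.exp (-66)) * localH (saddlePoint x y) q *
          (x ^ saddlePoint x y * smoothZeta (saddlePoint x y) y /
            Real.sqrt (2 * Real.pi * saddlePhi₂ (saddlePoint x y) y)) / (1 + |lam|) := by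
  obtain ⟨x₀, hmain⟩ := scaledSum_main_term hε
  refine ⟨max x₀ 1, fun x y hx hy4 hylog Λ hΛ1 hΛy q _ hqS hqL lam hlam => ?_⟩
  have hx₀ : x₀ ≤ x := le_trans (le_max_left _ _) hx
  have hx0 : 0 ≤ x := le_trans zero_le_one (le_trans (le_max_right _ _) hx)
  have hq : q ≠ 0 := NeZero.ne q
  set α : ℝ := saddlePoint x y with hα
  set M : ℝ := x ^ α * smoothZeta α y / Real.sqrt (2 * Real.pi * saddlePhi₂ α y) with hM
  rw [principalPart_eq_sum hx0 hqS lam]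
  -- `localG`, `localH` as the same double sums
  have hG : ((localG α q : ℝ) : ℂ) = ∑ g ∈ q.divisors, ∑ d ∈ (q / g).divisors,
      ((μ (q / g) : ℂ) * (μ d : ℂ) / ((Nat.totient (q / g) : ℂ))) * ((((g * d : ℕ) : ℝ) ^ (-α) : ℝ) : ℂ) := by
    unfold localG
    push_cast
    refine Finset.sum_congr rfl fun g _ => Finset.sum_congr rfl fun d _ => ?_
    ring
  -- the difference, term by term
  have hdiff : (∑ g ∈ q.divisors, ∑ d ∈ (q / g).divisors,
      ((μ (q / g) : ℂ) * (μ d : ℂ) / ((Nat.totient (q / g) : ℂ))) * smoothTwistSum (x / ((g * d : ℕ) : ℝ)) y lam) -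
      ((M : ℝ) : ℂ) * twistMellin lam α * (localG α q : ℂ) =
      ∑ g ∈ q.divisors, ∑ d ∈ (q / g).divisors,
        ((μ (q / g) : ℂ) * (μ d : ℂ) / ((Nat.totient (q / g) : ℂ))) *
          (smoothTwistSum (x / ((g * d : ℕ) : ℝ)) y lam -
            (((((g * d : ℕ) : ℝ) ^ (-α) * M : ℝ)) : ℂ) * twistMellin lam α) := by
    rw [hG, Finset.mul_sum]
    simp_rw [Finset.mul_sum, ← Finset.sum_sub_distrib]
    refine Finset.sum_congr rfl fun g _ => Finset.sum_congr rfl fun d _ => ?_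
    push_cast; ring
  rw [hdiff]
  -- bound each term by `|μμ|/φ · (gd)^{-α} ε' M/(1+|λ|)`
  have hterm : ∀ g ∈ q.divisors, ∀ d ∈ (q / g).divisors,
      ‖((μ (q / g) : ℂ) * (μ d : ℂ) / ((Nat.totient (q / g) : ℂ))) *
          (smoothTwistSum (x / ((g * d : ℕ) : ℝ)) y lam -
            (((((g * d : ℕ) : ℝ) ^ (-α) * M : ℝ)) : ℂ) * twistMellin lam α)‖ ≤
        |(μ (q / g) : ℝ)| * |(μ d : ℝ)| * ((g * d : ℕ) : ℝ) ^ (-α) / ((q / g).totient : ℝ) *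
          ((ε + Real.exp (-66)) * M / (1 + |lam|)) := by
    intro g hg d hd
    have hgq : g ∣ q := Nat.dvd_of_mem_divisors hg
    have hg0 : 0 < g := Nat.pos_of_mem_divisors hg
    have hd0 : 0 < d := Nat.pos_of_mem_divisors hd
    have hdq : d ∣ q / g := Nat.dvd_of_mem_divisors hd
    have hgd1 : 1 ≤ g * d := Nat.one_le_iff_ne_zero.mpr (mul_ne_zero hg0.ne' hd0.ne')
    have hgdq : g * d ∣ q := by
      obtain ⟨k, hk⟩ := hdq
      have := Nat.div_mul_cancel hgq
      refine ⟨k, ?_⟩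
      calc q = q / g * g := this.symm
        _ = d * k * g := by rw [hk]
        _ = g * d * k := by ring
    have hgdL : ((g * d : ℕ) : ℝ) ≤ Real.log x ^ 100 :=
      le_trans (by exact_mod_cast Nat.le_of_dvd (Nat.pos_of_ne_zero hq) hgdq) hqL
    have hS := hmain x y hx₀ hy4 hylog Λ hΛ1 hΛy (g * d) hgd1 hgdL lam hlam
    rw [← hα] at hS
    rw [norm_mul]
    have hcoef : ‖(μ (q / g) : ℂ) * (μ d : ℂ) / ((Nat.totient (q / g) : ℂ))‖ =
        |(μ (q / g) : ℝ)| * |(μ d : ℝ)| / ((q / g).totient : ℝ) := by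
      rw [norm_div, norm_mul, Complex.norm_intCast, Complex.norm_intCast, Complex.norm_natCast]
    rw [hcoef]
    have hφ0 : (0 : ℝ) ≤ ((q / g).totient : ℝ) := Nat.cast_nonneg _
    have hS' : ‖smoothTwistSum (x / ((g * d : ℕ) : ℝ)) y lam - (((((g * d : ℕ) : ℝ) ^ (-α) * M : ℝ)) : ℂ) * twistMellin lam α‖ ≤
        ((g * d : ℕ) : ℝ) ^ (-α) * ((ε + Real.exp (-66)) * M / (1 + |lam|)) := by
      simpa [smoothTwistSum, hM] using hS
    calc |(μ (q / g) : ℝ)| * |(μ d : ℝ)| / ((q / g).totient : ℝ) *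
          ‖smoothTwistSum (x / ((g * d : ℕ) : ℝ)) y lam - (((((g * d : ℕ) : ℝ) ^ (-α) * M : ℝ)) : ℂ) * twistMellin lam α‖
        ≤ |(μ (q / g) : ℝ)| * |(μ d : ℝ)| / ((q / g).totient : ℝ) *
            (((g * d : ℕ) : ℝ) ^ (-α) * ((ε + Real.exp (-66)) * M / (1 + |lam|))) :=
          mul_le_mul_of_nonneg_left hS' (by positivity)
      _ = _ := by ring
  calc ‖∑ g ∈ q.divisors, ∑ d ∈ (q / g).divisors,
        ((μ (q / g) : ℂ) * (μ d : ℂ) / ((Nat.totient (q / g) : ℂ))) *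
          (smoothTwistSum (x / ((g * d : ℕ) : ℝ)) y lam - (((((g * d : ℕ) : ℝ) ^ (-α) * M : ℝ)) : ℂ) * twistMellin lam α)‖
      ≤ ∑ g ∈ q.divisors, ∑ d ∈ (q / g).divisors,
          |(μ (q / g) : ℝ)| * |(μ d : ℝ)| * ((g * d : ℕ) : ℝ) ^ (-α) / ((q / g).totient : ℝ) *
            ((ε + Real.exp (-66)) * M / (1 + |lam|)) := by
        refine (norm_sum_le _ _).trans (Finset.sum_le_sum fun g hg => ?_)
        exact (norm_sum_le _ _).trans (Finset.sum_le_sum fun d hd => hterm g hg d hd)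
    _ = (ε + Real.exp (-66)) * localH α q * M / (1 + |lam|) := by
        rw [localH]
        simp_rw [← Finset.sum_mul]
        ring

end SmoothArcs

end Literature.NumberTheory.Sieve

end
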